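import Literature.NumberTheory.LFunctions.FreitasLiHalfPlanesProofs
import Literature.NumberTheory.LFunctions.RHWave0HardyProofs
import HarnessLib

/-!
# Freitas 2006 — proofs, part 4: Theorem 2 (iv) (the number of zeros of `α_n` on `(0,2)` is unbounded)

LABEL (line 1): **RH-FREE** (an oscillation count for the real-analytic functions `τ ↦ α_n(τ)` on
`(0,2)`; the Li-type criterion of the source — Theorem 1 at `τ = 1` is RH re-indexed — is used only
as the proved RH-FREE equivalence `Freitas2006_thm_1_holds`; nothing is asserted at `τ = 1`).
bears_on: LADDER-RH L-C/L-P (COLUMN 4, LI).  WHAT THIS IS NOT: nothing here bears on the truth of RH.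

Fourth companion of `FreitasLiHalfPlanes.lean`: the discharge `Freitas2006_thm_2_iv_holds` of the
named fact `Freitas2006_thm_2_iv` (P. Freitas, *A Li-type criterion for zero-free half-planes of
Riemann's zeta function*, J. London Math. Soc. (2) **73** (2006) 399–414 = arXiv:math/0507368,
Theorem 2 (iv), arXiv p0004:L38–40): "for any positive integer `N` there exists a positive integer `n₀`
such that the function `α_n(τ)` has at least `N` zeros on the interval `(0,2)`, for all `n` larger
than `n₀`" (zeros counted with multiplicity, `analyticOrderNatAt`).

Proof — the printed argument (p0009:L51–68), run with DISTINCT zeros (which makes the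
multiplicity bookkeeping of the printed proof unnecessary; every step below is a step of the
printed proof or of the proofs of Theorem 2 (ii)/(iii) it quotes):

1. Monotonicity (printed: "from points (ii) and (iii) it follows that `ν_n ≤ ν_{n+1}`"): if `α_n`
   has `k` distinct zeros `z_1 < ⋯ < z_k` in `(0,2)` then `α_{n+1}` has `k` distinct zeros in
   `(0, z_k)`: one in `(0, z_1)` (`exists_zero_freitasAlpha_succ`, the mechanism of Thm 2 (ii)) and
   one in each gap (`Freitas2006_thm_2_iii_holds`, Rolle for `t^{n+1} α_n`) — `card_zeros_mono`.
2. If the counts were bounded ("we argue by contradiction"), from some `p` on the zero set of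
   `α_n` in `(0,2)` is a finite set of constant size `A ≥ 1`, so by step 1 ALL zeros of `α_{n+1}` lie
   below the largest zero `w_n` of `α_n` ("all its positive zeros strictly to the left of `z_p`");
   `α_n > 0` on `(w_n, 2]` (no zero there and `α_n(2) > 0`, Lemma 3.1 (i) with `|ρ/(ρ−2)| < 1`).
3. The largest zero `w_p` is simple — the printed "zero of odd multiplicity": by the ODE of
   Theorem 4.3 (`freitasAlpha_ode`), `α_{p+1}(w_p) = (w_p/p) α_p'(w_p)`, and `w_p` is not a zero of
   `α_{p+1}`; hence `α_p` takes negative values immediately to the left of `w_p` (a two-sided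
   non-negative zero would be a local minimum with `α_p' = 0`).
4. Contradiction ("Proposition 4.1 gives that there are no zeros of `ξ` in the half-plane … by
   Theorem 1, this implies that there must exist zeros"): for `τ₀ ∈ (w_{p+1}, w_p)` with
   `α_p(τ₀) < 0`, every `α_k(τ₀)`, `k ≥ p+1`, is `> 0`, so by Corollary 4.2
   (`Freitas2006_cor_4_2_holds`, contrapositive) `Re s > τ₀/2` is zero-free, and then Theorem 1
   (`freitasAlpha_nonneg_of_riemannZeta_ne_zero`) gives `α_p(τ₀) ≥ 0`.  (When `w_{p+1} < 1/2` take
   `τ₀ = 1/2`: a zero on the critical line, `hardy_infinite_zeros_on_critical_line_holds`, lies in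
   `Re s > 1/4`.)
5. Multiplicities `≥ 1` at the exhibited zeros: `τ ↦ α_n(τ)` is real-analytic on `ℝ`
   (`AnalyticAt.re_ofReal`) and not locally zero (`α_n(2) > 0`, identity theorem).

## Contents

* `FreitasOscillation.freitasAlpha_two_pos` — `α_n(2) > 0` (`n ≥ 1`).
* `FreitasOscillation.analyticAt_freitasAlpha`, `.one_le_analyticOrderNatAt_freitasAlpha`.
* `FreitasOscillation.card_zeros_mono` — step 1.
* `FreitasOscillation.exists_card_zeros` — for every `N` some `α_n` (`n ≥ 1`) has `N` distinct zeros in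
  `(0,2)` (steps 2–4).
* `Freitas2006_thm_2_iv_holds`.

## References

* P. Freitas, J. London Math. Soc. (2) 73 (2006) 399–414 = arXiv:math/0507368, Thm 2 (iv) and its
  proof p0009:L51–68. [Freitas2006LiHalfPlanes]
-/

noncomputable section

open Complex Filter Set Metric
open scoped Nat Topology

namespace Literature.NumberTheory.LFunctions

namespace FreitasOscillation

open ZetaZeros

/-! ## Analytic preliminaries: `α_n(2) > 0`, real-analyticity, orders of zeros -/

/-- For a non-trivial zero `ρ` (so `Re ρ < 1`), `|ρ/(ρ − 2)| < 1`. [folklore] -/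
private theorem norm_div_sub_two_lt_one (ρ : ZetaZeros.riemannZetaNontrivialZeros) :
    ‖(ρ : ℂ) / ((ρ : ℂ) - 2)‖ < 1 := by
  have h1 : (ρ : ℂ).re < 1 := riemannZetaNontrivialZeros.re_lt_one ρ.2
  have hne : (ρ : ℂ) - 2 ≠ 0 := by
    intro e
    have := congrArg Complex.re e
    simp only [sub_re, re_ofNat, zero_re] at this
    linarith
  rw [norm_div, div_lt_one (norm_pos_iff.2 hne), ← sq_lt_sq₀ (norm_nonneg _) (norm_nonneg _),
    Complex.sq_norm, Complex.sq_norm, Complex.normSq_apply, Complex.normSq_apply]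
  simp only [sub_re, re_ofNat, sub_im, im_ofNat, sub_zero]
  nlinarith

/-- `Re(1 − wⁿ) > 0` for `|w| < 1` and `n ≥ 1`. [folklore] -/
private theorem re_one_sub_pow_pos {w : ℂ} (hw : ‖w‖ < 1) {n : ℕ} (hn : 1 ≤ n) :
    0 < (1 - w ^ n).re := by
  have h1 : (w ^ n).re ≤ ‖w ^ n‖ := Complex.re_le_norm _
  have h2 : ‖w ^ n‖ < 1 := by
    rw [norm_pow]; exact pow_lt_one₀ (norm_nonneg _) hw (by omega)
  simp only [sub_re, one_re]
  linarith

/-- **`α_n(2) > 0`** for `n ≥ 1` ("for `τ` greater than or equal to two we are outside the critical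
strip", p0003:L130–132, strict form): by Lemma 3.1 (i), `α_n(2) = ½ Σ_ρ m(ρ) Re[1 − (ρ/(ρ−2))ⁿ]` with
every term positive (`|ρ/(ρ−2)| < 1` as `Re ρ < 1`), and there is a zero (Hardy).
[cite: Freitas2006LiHalfPlanes, §1 (remark before Theorem 1) with Lemma 3.1 (i)] -/
theorem freitasAlpha_two_pos {n : ℕ} (hn : 1 ≤ n) : 0 < freitasAlpha 2 n := by
  obtain ⟨hs, hα⟩ := Freitas2006_lemma_3_1_i_holds n hn 2 two_ne_zero
  rw [hα]
  refine mul_pos (by norm_num) ?_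
  have hterm : ∀ ρ : ZetaZeros.riemannZetaNontrivialZeros,
      0 < (riemannZetaZeroOrder (ρ : ℂ) : ℝ) * (1 - ((ρ : ℂ) / ((ρ : ℂ) - (2 : ℝ))) ^ n).re := by
    intro ρ
    refine mul_pos (FordL33.order_pos ρ) ?_
    have h := norm_div_sub_two_lt_one ρ
    rw [show ((2 : ℝ) : ℂ) = 2 by norm_num]
    exact re_one_sub_pow_pos h hn
  -- a non-trivial zero exists (Hardy's theorem, tree)
  obtain ⟨t, ht⟩ := hardy_infinite_zeros_on_critical_line_holds.nonempty
  have hmem : (1 / 2 + t * I : ℂ) ∈ ZetaZeros.riemannZetaNontrivialZeros :=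
    riemannZetaNontrivialZeros.mem_iff'.2 ⟨ht, by simp, by norm_num⟩
  exact hs.tsum_pos (fun ρ ↦ (hterm ρ).le) ⟨_, hmem⟩ (hterm ⟨_, hmem⟩)

/-- **`τ ↦ α_n(τ)` is real-analytic on `ℝ`** ("these functions are analytic for real values of `τ`",
p0003:L122–123): the real part, along the real axis, of the holomorphic function
`s ↦ dⁿ/dsⁿ[s^{n−1} log ξ(s)]/(n−1)!` (`ξ > 0` on `ℝ`).
[cite: Freitas2006LiHalfPlanes, §1 (after eq. (dcoeff), arXiv p0003:L122)] -/
theorem analyticAt_freitasAlpha (n : ℕ) (τ : ℝ) :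
    AnalyticAt ℝ (fun t : ℝ ↦ freitasAlpha t n) τ := by
  have hg : AnalyticAt ℂ (fun s : ℂ ↦ s ^ (n - 1) * Complex.log (riemannXi s)) τ :=
    (analyticAt_id.pow _).mul (analyticAt_log_riemannXi_ofReal τ)
  have hA : AnalyticAt ℂ (iteratedDeriv n (fun s : ℂ ↦ s ^ (n - 1) * Complex.log (riemannXi s))) τ := by
    obtain ⟨ε, hε, hball⟩ := Metric.eventually_nhds_iff_ball.1 hg.eventually_analyticAt
    have hOn : AnalyticOnNhd ℂ (fun s : ℂ ↦ s ^ (n - 1) * Complex.log (riemannXi s)) (ball (τ : ℂ) ε) :=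
      fun z hz ↦ hball z hz
    rw [iteratedDeriv_eq_iterate]
    exact (hOn.iterated_deriv n) _ (mem_ball_self hε)
  have hH : AnalyticAt ℂ (fun s : ℂ ↦
      iteratedDeriv n (fun s : ℂ ↦ s ^ (n - 1) * Complex.log (riemannXi s)) s / ((n - 1)! : ℂ)) τ :=
    hA.div analyticAt_const (by exact_mod_cast Nat.factorial_ne_zero (n - 1))
  exact hH.re_ofReal

/-- `τ ↦ α_n(τ)` (`n ≥ 1`) is not locally zero anywhere: it is real-analytic on the connected line and
`α_n(2) > 0` (identity theorem). [folklore] -/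
private theorem analyticOrderAt_freitasAlpha_ne_top {n : ℕ} (hn : 1 ≤ n) (τ : ℝ) :
    analyticOrderAt (fun t : ℝ ↦ freitasAlpha t n) τ ≠ ⊤ := by
  have hOn : AnalyticOnNhd ℝ (fun t : ℝ ↦ freitasAlpha t n) Set.univ :=
    fun t _ ↦ analyticAt_freitasAlpha n t
  have h2 : analyticOrderAt (fun t : ℝ ↦ freitasAlpha t n) 2 = 0 :=
    (analyticAt_freitasAlpha n 2).analyticOrderAt_eq_zero.2 (freitasAlpha_two_pos hn).ne'
  refine hOn.analyticOrderAt_ne_top_of_isPreconnected isPreconnected_univ (Set.mem_univ 2)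
    (Set.mem_univ τ) ?_
  rw [h2]
  exact ENat.coe_ne_top 0

/-- At a zero `z` of `α_n` (`n ≥ 1`) the multiplicity ("counting multiplicities", p0009:L51–52:
the order `analyticOrderNatAt` of the real-analytic `τ ↦ α_n(τ)`) is `≥ 1` — `α_n` is nowhere
locally zero. [cite: Freitas2006LiHalfPlanes, proof of Theorem 2 (iv) (arXiv p0009:L51–52, multiplicities)] -/
theorem one_le_analyticOrderNatAt_freitasAlpha {n : ℕ} (hn : 1 ≤ n) {z : ℝ}
    (hz : freitasAlpha z n = 0) : 1 ≤ analyticOrderNatAt (fun t : ℝ ↦ freitasAlpha t n) z := by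
  have hne0 : analyticOrderAt (fun t : ℝ ↦ freitasAlpha t n) z ≠ 0 :=
    (analyticAt_freitasAlpha n z).analyticOrderAt_ne_zero.2 hz
  have hnet := analyticOrderAt_freitasAlpha_ne_top hn z
  unfold analyticOrderNatAt
  obtain ⟨k, hk⟩ := ENat.ne_top_iff_exists.1 hnet
  rw [← hk, ENat.toNat_coe]
  rw [← hk] at hne0
  have : k ≠ 0 := fun h ↦ hne0 (by rw [h]; rfl)
  omega

/-- `α_n` (`n ≥ 1`) has a zero in `(0,2)`: `α_n(0) < 0` (Theorem 2 (i)) and `α_n(2) > 0`.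
[cite: Freitas2006LiHalfPlanes, Theorem 2 (ii) (a zero `a_n ≤ 1/2`)] -/
theorem exists_zero_Ioo {n : ℕ} (hn : 1 ≤ n) : ∃ z : ℝ, 0 < z ∧ z < 2 ∧ freitasAlpha z n = 0 := by
  have h0 : freitasAlpha 0 n < 0 := (Freitas2006_thm_2_i_holds n hn).2
  have h2 : 0 < freitasAlpha 2 n := freitasAlpha_two_pos hn
  obtain ⟨z, hz, hz0⟩ := intermediate_value_Ioo (f := fun t : ℝ ↦ freitasAlpha t n)
    (by norm_num : (0 : ℝ) ≤ 2) (continuous_freitasAlpha n).continuousOn ⟨h0, h2⟩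
  exact ⟨z, hz.1, hz.2, hz0⟩

/-- If every zero of `α_k` (`k ≥ 1`) in `(0,2)` lies below `c ∈ (0,2]`, then `α_k(c) > 0`
(no zero in `[c,2)`, `α_k(2) > 0`, intermediate values). [folklore] -/
private theorem pos_of_zeros_lt {k : ℕ} (hk : 1 ≤ k) {c : ℝ} (hc0 : 0 < c) (hc2 : c ≤ 2)
    (hQ : ∀ z : ℝ, 0 < z → z < 2 → freitasAlpha z k = 0 → z < c) : 0 < freitasAlpha c k := by
  by_contra hle
  push Not at hle
  rcases hc2.eq_or_lt with rfl | hc2'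
  · exact absurd (freitasAlpha_two_pos hk) (not_lt.2 hle)
  rcases hle.eq_or_lt with h0 | hneg
  · exact lt_irrefl c (hQ c hc0 hc2' h0)
  · obtain ⟨z, hz, hz0⟩ := intermediate_value_Ioo (f := fun t : ℝ ↦ freitasAlpha t k) hc2'.le
      (continuous_freitasAlpha k).continuousOn ⟨hneg, freitasAlpha_two_pos hk⟩
    have := hQ z (hc0.trans hz.1) hz.2 hz0
    linarith [hz.1]

/-! ## Step 1: the number of distinct zeros of `α_n` in `(0,2)` does not decrease with `n` -/

/-- **Monotonicity of the zero count** ("from points (ii) and (iii) it follows that `ν_n ≤ ν_{n+1}`",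
p0009:L52–53, for distinct zeros): if `T` is a finite set of zeros of `α_n` (`n ≥ 1`) in `(0,2)`,
then `α_{n+1}` has a set `T'` of zeros with `#T' = #T`, every element of which is positive and lies
below some element of `T` — one zero below the least element of `T` (`exists_zero_freitasAlpha_succ`)
and one in each gap (Theorem 2 (iii)). [cite: Freitas2006LiHalfPlanes, proof of Theorem 2 (iv) (arXiv p0009:L51–53)] -/
theorem card_zeros_mono {n : ℕ} (hn : 1 ≤ n) (T : Finset ℝ)
    (hT : ∀ z ∈ T, 0 < z ∧ z < 2 ∧ freitasAlpha z n = 0) :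
    ∃ T' : Finset ℝ, T'.card = T.card ∧ (∀ z ∈ T', 0 < z ∧ freitasAlpha z (n + 1) = 0) ∧
      ∀ z ∈ T', ∃ y ∈ T, z < y := by
  classical
  induction T using Finset.induction_on_max with
  | empty => exact ⟨∅, rfl, by simp, by simp⟩
  | insert a s ha ih =>
    have hT' : ∀ z ∈ s, 0 < z ∧ z < 2 ∧ freitasAlpha z n = 0 :=
      fun z hz ↦ hT z (Finset.mem_insert_of_mem hz)
    obtain ⟨T₀, hcard, hzero, hbelow⟩ := ih hT'
    obtain ⟨ha0, ha2, hαa⟩ := hT a (Finset.mem_insert_self a s)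
    have has : a ∉ s := fun h ↦ lt_irrefl a (ha a h)
    -- a new zero of `α_{n+1}` in `(0, a)`, above every element of `T₀`
    obtain ⟨y₀, hy0, hya, hyα, hyT₀⟩ : ∃ y₀ : ℝ, 0 < y₀ ∧ y₀ < a ∧ freitasAlpha y₀ (n + 1) = 0 ∧
        ∀ z ∈ T₀, z < y₀ := by
      rcases s.eq_empty_or_nonempty with hs | hs
      · subst hs
        obtain ⟨y, hy0, hya, hy⟩ := exists_zero_freitasAlpha_succ hn ha0 hαa
        have hT₀ : T₀ = ∅ := Finset.card_eq_zero.1 (by rw [hcard, Finset.card_empty])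
        subst hT₀
        exact ⟨y, hy0, hya, hy, by simp⟩
      · have hb : s.max' hs ∈ s := Finset.max'_mem s hs
        obtain ⟨hb0, -, hαb⟩ := hT' _ hb
        obtain ⟨y, hby, hya, hy⟩ :=
          Freitas2006_thm_2_iii_holds n hn (s.max' hs) a hb0.le (ha _ hb) ha2 hαb hαa
        refine ⟨y, hb0.trans hby, hya, hy, fun z hz ↦ ?_⟩
        obtain ⟨w, hw, hzw⟩ := hbelow z hz
        exact hzw.trans ((Finset.le_max' s w hw).trans_lt hby)
    refine ⟨insert y₀ T₀, ?_, ?_, ?_⟩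
    · have hy₀T : y₀ ∉ T₀ := fun h ↦ lt_irrefl _ (hyT₀ y₀ h)
      rw [Finset.card_insert_of_notMem hy₀T, Finset.card_insert_of_notMem has, hcard]
    · intro z hz
      rcases Finset.mem_insert.1 hz with rfl | hz
      · exact ⟨hy0, hyα⟩
      · exact hzero z hz
    · intro z hz
      rcases Finset.mem_insert.1 hz with rfl | hz
      · exact ⟨a, Finset.mem_insert_self a s, hya⟩
      · obtain ⟨w, hw, hzw⟩ := hbelow z hz
        exact ⟨w, Finset.mem_insert_of_mem hw, hzw⟩

/-- Transport of a zero count: `k` distinct zeros of `α_n` in `(0,2)` (`n ≥ 1`) give `k` distinct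
zeros of `α_m` in `(0,2)` for every `m ≥ n`. [cite: Freitas2006LiHalfPlanes, proof of Theorem 2 (iv) (arXiv p0009:L51–53)] -/
theorem exists_card_zeros_of_le {n k : ℕ} (hn : 1 ≤ n)
    (h : ∃ T : Finset ℝ, T.card = k ∧ ∀ z ∈ T, 0 < z ∧ z < 2 ∧ freitasAlpha z n = 0)
    {m : ℕ} (hm : n ≤ m) :
    ∃ T : Finset ℝ, T.card = k ∧ ∀ z ∈ T, 0 < z ∧ z < 2 ∧ freitasAlpha z m = 0 := by
  induction m, hm using Nat.le_induction with
  | base => exact h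
  | succ m hnm ih =>
    obtain ⟨T, hcard, hT⟩ := ih
    obtain ⟨T', hcard', hzero, hbelow⟩ := card_zeros_mono (hn.trans hnm) T hT
    refine ⟨T', hcard'.trans hcard, fun z hz ↦ ⟨(hzero z hz).1, ?_, (hzero z hz).2⟩⟩
    obtain ⟨y, hy, hzy⟩ := hbelow z hz
    exact hzy.trans (hT y hy).2.1

/-! ## Steps 2–4: the zero counts are unbounded -/

/-- **For every `N`, some `α_n` (`n ≥ 1`) has `N` distinct zeros in `(0,2)`** — the contradiction
argument of the printed proof of Theorem 2 (iv) (p0009:L53–68), see the module docstring.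
[cite: Freitas2006LiHalfPlanes, proof of Theorem 2 (iv) (arXiv p0009:L53–68)] -/
theorem exists_card_zeros (N : ℕ) :
    ∃ n : ℕ, 1 ≤ n ∧ ∃ T : Finset ℝ, T.card = N ∧ ∀ z ∈ T, 0 < z ∧ z < 2 ∧ freitasAlpha z n = 0 := by
  classical
  rcases Nat.eq_zero_or_pos N with rfl | hN
  · exact ⟨1, le_rfl, ∅, rfl, by simp⟩
  by_contra hcon
  have hnot : ∀ n, 1 ≤ n →
      ¬ ∃ T : Finset ℝ, T.card = N ∧ ∀ z ∈ T, 0 < z ∧ z < 2 ∧ freitasAlpha z n = 0 :=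
    fun n hn h ↦ hcon ⟨n, hn, h⟩
  -- the largest attainable count `A < N`
  set Pk : ℕ → Prop := fun k ↦ ∃ n : ℕ, 1 ≤ n ∧
    ∃ T : Finset ℝ, T.card = k ∧ ∀ z ∈ T, 0 < z ∧ z < 2 ∧ freitasAlpha z n = 0 with hPk
  have hP1 : Pk 1 := by
    obtain ⟨z, hz0, hz2, hz⟩ := exists_zero_Ioo (n := 1) le_rfl
    refine ⟨1, le_rfl, {z}, Finset.card_singleton z, fun w hw ↦ ?_⟩
    rw [Finset.mem_singleton] at hw
    subst hw
    exact ⟨hz0, hz2, hz⟩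
  set A := Nat.findGreatest Pk N with hA
  have hA1 : 1 ≤ A := Nat.le_findGreatest hN hP1
  have hPA : Pk A := Nat.findGreatest_spec hN hP1
  have hAN : A ≤ N := Nat.findGreatest_le N
  have hmax : ∀ k, k ≤ N → Pk k → k ≤ A := fun k hk h ↦ Nat.le_findGreatest hk h
  obtain ⟨p, hp, hTp⟩ := hPA
  have hAltN : A < N := by
    refine lt_of_le_of_ne hAN fun h ↦ hnot p hp ?_
    rw [← h]; exact hTp
  -- no `α_n` (`n ≥ 1`) has `A + 1` distinct zeros in `(0,2)`
  have hno : ∀ n, 1 ≤ n →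
      ¬ ∃ T : Finset ℝ, T.card = A + 1 ∧ ∀ z ∈ T, 0 < z ∧ z < 2 ∧ freitasAlpha z n = 0 := by
    intro n hn h
    have := hmax (A + 1) hAltN ⟨n, hn, h⟩
    omega
  -- hence a set of `A` zeros of `α_n` contains every zero of `α_n` in `(0,2)`
  have hfull : ∀ n, 1 ≤ n → ∀ T : Finset ℝ, T.card = A →
      (∀ z ∈ T, 0 < z ∧ z < 2 ∧ freitasAlpha z n = 0) →
      ∀ z, 0 < z → z < 2 → freitasAlpha z n = 0 → z ∈ T := by
    intro n hn T hcard hT z hz0 hz2 hz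
    by_contra hzT
    refine hno n hn ⟨insert z T, by rw [Finset.card_insert_of_notMem hzT, hcard], fun w hw ↦ ?_⟩
    rcases Finset.mem_insert.1 hw with rfl | hw
    · exact ⟨hz0, hz2, hz⟩
    · exact hT w hw
  -- step 1 at size `A`: the zeros of `α_{n+1}` sit below zeros of `α_n`
  have hprop : ∀ n, 1 ≤ n → ∀ T : Finset ℝ, T.card = A →
      (∀ z ∈ T, 0 < z ∧ z < 2 ∧ freitasAlpha z n = 0) →
      ∃ T' : Finset ℝ, T'.card = A ∧ (∀ z ∈ T', 0 < z ∧ z < 2 ∧ freitasAlpha z (n + 1) = 0) ∧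
        ∀ z ∈ T', ∃ y ∈ T, z < y := by
    intro n hn T hcard hT
    obtain ⟨T', hcard', hzero, hbelow⟩ := card_zeros_mono hn T hT
    refine ⟨T', hcard'.trans hcard, fun z hz ↦ ⟨(hzero z hz).1, ?_, (hzero z hz).2⟩, hbelow⟩
    obtain ⟨y, hy, hzy⟩ := hbelow z hz
    exact hzy.trans (hT y hy).2.1
  -- step 2: an upper barrier `c` for the zeros of `α_n` stays a barrier for all `α_m`, `m ≥ n`
  have hQ : ∀ n, 1 ≤ n → ∀ c : ℝ,
      (∃ T : Finset ℝ, T.card = A ∧ ∀ z ∈ T, 0 < z ∧ z < 2 ∧ freitasAlpha z n = 0) →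
      (∀ z, 0 < z → z < 2 → freitasAlpha z n = 0 → z < c) →
      ∀ m, n ≤ m →
        (∃ T : Finset ℝ, T.card = A ∧ ∀ z ∈ T, 0 < z ∧ z < 2 ∧ freitasAlpha z m = 0) ∧
          ∀ z, 0 < z → z < 2 → freitasAlpha z m = 0 → z < c := by
    intro n hn c hT hc m hm
    induction m, hm using Nat.le_induction with
    | base => exact ⟨hT, hc⟩
    | succ m hnm ih =>
      obtain ⟨⟨T, hcard, hTz⟩, hcm⟩ := ih
      obtain ⟨T', hcard', hT'z, hbelow⟩ := hprop m (hn.trans hnm) T hcard hTz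
      refine ⟨⟨T', hcard', hT'z⟩, fun z hz0 hz2 hz ↦ ?_⟩
      obtain ⟨y, hy, hzy⟩ := hbelow z (hfull (m + 1) (by omega) T' hcard' hT'z z hz0 hz2 hz)
      obtain ⟨hy0, hy2, hyz⟩ := hTz y hy
      exact hzy.trans (hcm y hy0 hy2 hyz)
  -- the zero set of `α_p` and its largest element `wp`
  obtain ⟨Tp, hTpcard, hTpz⟩ := hTp
  have hTpne : Tp.Nonempty := by rw [← Finset.card_pos, hTpcard]; exact hA1
  obtain ⟨wp, hwp⟩ : ∃ w, w = Tp.max' hTpne := ⟨_, rfl⟩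
  have hwpmem : wp ∈ Tp := hwp ▸ Finset.max'_mem _ _
  have hlewp : ∀ y ∈ Tp, y ≤ wp := fun y hy ↦ hwp ▸ Finset.le_max' Tp y hy
  obtain ⟨hwp0, hwp2, hwpz⟩ := hTpz wp hwpmem
  -- the zero set of `α_{p+1}`: below `wp`; its largest element `w1 < wp`
  obtain ⟨T1, hT1card, hT1z, hT1below⟩ := hprop p hp Tp hTpcard hTpz
  have hzeros1 : ∀ z, 0 < z → z < 2 → freitasAlpha z (p + 1) = 0 → z < wp := by
    intro z hz0 hz2 hz
    obtain ⟨y, hy, hzy⟩ := hT1below z (hfull (p + 1) (by omega) T1 hT1card hT1z z hz0 hz2 hz)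
    exact hzy.trans_le (hlewp y hy)
  have hT1ne : T1.Nonempty := by rw [← Finset.card_pos, hT1card]; exact hA1
  obtain ⟨w1, hw1⟩ : ∃ w, w = T1.max' hT1ne := ⟨_, rfl⟩
  have hw1mem : w1 ∈ T1 := hw1 ▸ Finset.max'_mem _ _
  obtain ⟨hw10, hw12, hw1z⟩ := hT1z w1 hw1mem
  have hw1wp : w1 < wp := hzeros1 w1 hw10 hw12 hw1z
  have hzeros1' : ∀ z, 0 < z → z < 2 → freitasAlpha z (p + 1) = 0 → z ≤ w1 := fun z hz0 hz2 hz ↦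
    hw1 ▸ Finset.le_max' T1 z (hfull (p + 1) (by omega) T1 hT1card hT1z z hz0 hz2 hz)
  -- `α_p > 0` on `(wp, 2]`
  have hpos_p : ∀ τ, wp < τ → τ ≤ 2 → 0 < freitasAlpha τ p := fun τ h1 h2 ↦
    pos_of_zeros_lt hp (hwp0.trans h1) h2 fun z hz0 hz2 hz ↦
      (hlewp z (hfull p hp Tp hTpcard hTpz z hz0 hz2 hz)).trans_lt h1
  -- step 3: `wp` is a simple zero of `α_p` (ODE of Theorem 4.3: else `α_{p+1}(wp) = 0`)
  have hderiv : deriv (fun t : ℝ ↦ freitasAlpha t p) wp ≠ 0 := by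
    intro hd
    have hode := freitasAlpha_ode wp hp
    rw [hd, hwpz, mul_zero, mul_zero, zero_add] at hode
    exact lt_irrefl wp (hzeros1 wp hwp0 hwp2 hode.symm)
  -- … so `α_p` takes negative values immediately to the left of `wp`
  have hnegleft : ∀ c, c < wp → ∃ τ, c < τ ∧ τ < wp ∧ freitasAlpha τ p < 0 := by
    intro c hc
    by_contra hne
    push Not at hne
    have hmin : IsLocalMin (fun t : ℝ ↦ freitasAlpha t p) wp := by
      have hnhds : Set.Ioo c 2 ∈ 𝓝 wp := Ioo_mem_nhds hc hwp2
      filter_upwards [hnhds] with t ht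
      show freitasAlpha wp p ≤ freitasAlpha t p
      rw [hwpz]
      rcases lt_trichotomy t wp with hlt | heq | hgt
      · exact hne t ht.1 hlt
      · rw [heq, hwpz]
      · exact (hpos_p t hgt ht.2.le).le
    exact hderiv hmin.deriv_eq_zero
  -- step 4 (Corollary 4.2): positivity of all `α_k(τ₀)`, `k ≥ p+1`, forces a zero-free half-plane
  have hfree : ∀ τ₀ : ℝ, 1 / 2 ≤ τ₀ → τ₀ < 2 → (∀ k, p + 1 ≤ k → 0 < freitasAlpha τ₀ k) →
      ∀ s : ℂ, τ₀ / 2 < s.re → riemannZeta s ≠ 0 := by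
    intro τ₀ h1 h2 hposk
    by_contra hnz
    obtain ⟨n', hmono, hn'⟩ := Freitas2006_cor_4_2_holds τ₀ h1 h2 hnz
    have hge : p + 1 ≤ n' (p + 1) := hmono.le_apply
    have := hposk _ hge
    linarith [(hn' (p + 1)).2]
  -- all `α_k(τ₀)`, `k ≥ p+1`, are positive as soon as `τ₀ > w1`
  have hposk : ∀ τ₀ : ℝ, w1 < τ₀ → τ₀ ≤ 2 → ∀ k, p + 1 ≤ k → 0 < freitasAlpha τ₀ k := by
    intro τ₀ hτ₀ hτ₀2 k hk
    have hQk := (hQ (p + 1) (by omega) τ₀ ⟨T1, hT1card, hT1z⟩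
      (fun z hz0 hz2 hz ↦ (hzeros1' z hz0 hz2 hz).trans_lt hτ₀) k hk).2
    exact pos_of_zeros_lt (by omega) (hw10.trans hτ₀) hτ₀2 hQk
  rcases le_or_gt (1 / 2 : ℝ) w1 with hcase | hcase
  · -- `1/2 ≤ w1 < τ₀ < wp` with `α_p(τ₀) < 0`: zero-free half-plane, yet Theorem 1 forces `α_p(τ₀) ≥ 0`
    obtain ⟨τ₀, hτ₀1, hτ₀2, hneg⟩ := hnegleft w1 hw1wp
    have hz := hfree τ₀ (hcase.trans hτ₀1.le) (hτ₀2.trans hwp2) (hposk τ₀ hτ₀1 (by linarith))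
    have := freitasAlpha_nonneg_of_riemannZeta_ne_zero (by linarith) hz hp
    linarith
  · -- `w1 < 1/2`: `Re s > 1/4` would be zero-free — a zero on the critical line (Hardy) says no
    have hz := hfree (1 / 2) le_rfl (by norm_num) (hposk (1 / 2) hcase (by norm_num))
    obtain ⟨t, ht⟩ := hardy_infinite_zeros_on_critical_line_holds.nonempty
    have hre : (1 / 2 + (t : ℂ) * I).re = 1 / 2 := by simp
    exact hz (1 / 2 + t * I) (by rw [hre]; norm_num) ht

end FreitasOscillation

open FreitasOscillation in
/-- **Freitas 2006, Theorem 2 (iv)** — DISCHARGED (RH-FREE): for every `N` there is `n₀` such that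
for all `n > n₀` the function `τ ↦ α_n(τ)` has at least `N` zeros in `(0,2)`, counted with
multiplicity (indeed `N` distinct ones).  Printed proof (p0009:L51–68) followed with distinct zeros,
see the module docstring. [cite: Freitas2006LiHalfPlanes, Theorem 2 (iv)] -/
theorem Freitas2006_thm_2_iv_holds : Freitas2006_thm_2_iv := by
  intro N
  obtain ⟨n₁, hn₁, hT⟩ := exists_card_zeros N
  refine ⟨n₁, fun n hn ↦ ?_⟩
  obtain ⟨T, hcard, hTz⟩ := exists_card_zeros_of_le hn₁ hT hn.le
  refine ⟨T, hTz, ?_⟩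
  calc N = ∑ z ∈ T, 1 := by rw [Finset.sum_const, smul_eq_mul, mul_one, hcard]
    _ ≤ ∑ z ∈ T, analyticOrderNatAt (fun t : ℝ ↦ freitasAlpha t n) z :=
        Finset.sum_le_sum fun z hz ↦
          one_le_analyticOrderNatAt_freitasAlpha (by omega) (hTz z hz).2.2

end Literature.NumberTheory.LFunctions
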